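import Literature.AnabelianGeometry.SemiGraphs.PSCOpenInterOfUnrCharacters
import Literature.AnabelianGeometry.SemiGraphs.ProSigmaCompletionExtend
import Literature.GroupTheory.CombinatorialGroupTheory.PuncturedSurfaceGroup
import Mathlib.Algebra.BigOperators.Fin
import Mathlib.Topology.Instances.ZMod
import Mathlib.Algebra.Group.TypeTags.Finite
import HarnessLib

/-!
# [CombGC] Prop. 1.2 (i) at GENUINE TWO-COMPONENT data WITH CUSPS (the shape; verticial case)

Mochizuki, *A combinatorial version of the Grothendieck conjecture* [CombGC] §1, Prop. 1.2 (i) p. 8 ("If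
`A₁ ∩ A₂` is open in `A₁`, then `v₁ = v₂`", and the unramified case "under the further assumption that
`G` is sturdy") [cite: MochizukiCombGC2007, Prop 1.2(i) p.8].  PROOF-ONLY file (abc-iut-f-164 gen 2,
FACT tranche 164; row F-0459 `PSCDatum.OpenInterDeterminesComponentHolds`, a schema over the origin
parameter `Ω : PSCOrigin` typed by abc-iut-L3-t4; the edge-like and unramified cases and the assembly
with rows F-1931 / F-0458 = [CombGC] Thm. 1.6 (i) are in the companion files
`PSCTwoComponentAffineShapeEdges.lean`, `PSCTwoComponentAffineOrigin.lean`).  Purpose: the first kernel instances of the [CombGC] §1 rows at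
MULTI-VERTEX data CARRYING CUSPS (abc-iut-L3-t4's `PSC-ORIGIN-ROWS-STATUS.md`: "What is NOT known in
kernel: any row at genuine MULTI-VERTEX data"; the two-component CLOSED shape, no cusps, is
abc-iut-f-165's `PSCTwoComponentShape.lean`, whose character criterion
`PSCOpenInterOfUnrCharacters.lean` is reused here BY NAME).

## The shape: two pointed components glued at one node

THE DATA OF TWO-COMPONENT AFFINE SHAPE are what [CombGC] Def. 1.1 extracts from a pointed stable curve
`C₀ ∪_ν C₁` over an algebraically closed field of characteristic `∉ Σ` with two irreducible components of
genera `g₀`, `g − g₀`, ONE node `ν`, and marked points on both components — `r − s ≥ 2` of them on `C₀`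
and `s ≥ 2` on `C₁` (dual semi-graph: two vertices, one closed edge joining them, `r` open edges).  Along
the specialisation isomorphism, `Π_G` is a pro-`Σ` completion `ι : Γ_{g,r} → Π` of the punctured surface
group `Γ_{g,r} = ⟨a_i, b_i, c_j ∣ ∏_i [a_i,b_i] · c_0 ⋯ c_{r−1}⟩` (`PuncturedSurfaceGroup g r`) of the
smooth curve of type `(g, r)` into which `C₀ ∪_ν C₁` deforms, and
* `Π_{c_j}` = closure `ι⟨c_j⟩` (cusp inertia) — the cusps `s ≤ j` lie on `C₀`, the cusps `j < s` on `C₁`;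
* `Π_{v₀}` = closure `ι⟨a_i, b_i (i < g₀), c_j (s ≤ j)⟩`, `Π_{v₁}` = closure
  `ι⟨a_i, b_i (g₀ ≤ i), c_j (j < s), ε⟩`, genus`(v₀) = g₀`, genus`(v₁) = g − g₀`;
* `Π_ν` = closure `ι⟨ε⟩`, where `ε := (c_s ⋯ c_{r−1}) · ∏_{i<g₀} [a_i, b_i]` is the loop around the node
  seen from `C₀`: a CONSECUTIVE cyclic sub-word of the relator, so that
  `ε⁻¹ = ∏_{i ≥ g₀} [a_i,b_i] · c_0 ⋯ c_{s−1}` is the same loop seen from `C₁` — the separating simple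
  closed curve cutting the topological surface `S_{g,r}` into `S_{g₀, (r−s)+1}` and `S_{g−g₀, s+1}`.
(`ε` is written below with the two ordered list products over `Fin r` / `Fin g` padded by `1`'s — the same
element of `Γ_{g,r}`.)  These are HYPOTHESES `hC`, `hV₀`, `hV₁`, `hE`, … on a `PSCDatum`; no predicate is
defined.  The identification of the PSC-fundamental group of `C₀ ∪_ν C₁` with the pro-`Σ` completion of
`π₁(S_{g,r})` (SGA 1 specialisation + van Kampen) is NOT constructed in the tree (FOUNDATIONS rows 13–14):
an instance at data of this shape is consistency evidence for the typed rows, not the printed theorems for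
all pointed stable curves.

## The argument (Prop. 1.2 (i), verticial and unramified cases)

By abc-iut-f-165's criterion (`verticialOpenInterDeterminesVertex_of_characters` / the profinite
pigeonhole `not_isOpen_inf_subgroupOf_of_characters`) it suffices to exhibit, for `v ≠ w`, an `x ∈ Π_v`
and for every `n` a homomorphism `χ : Π → ℤ/ℓⁿ` (`ℓ ∈ Σ`) killing `Π_w` with `χ(x) = 1`: `x = ι(c_s)` resp.
`ι(c_0)` and `χ` the continuous extension (`IsProSigmaCompletion.exists_continuous_extend_top`) of the cusp
character `c_s ↦ 1, c_{s+1} ↦ −1` resp. `c_0 ↦ 1, c_1 ↦ −1` — two cusps on the SAME component, so the node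
loop `ε` has weight `1 − 1 = 0` and `χ` kills every generator of `Π_w` (this is where "at least two marked
points on each component" is used).  Unramified case (`G` sturdy, so `g₀, g − g₀ ≥ 2`):
`x = γ₁ι(a_0)γ₁⁻¹` resp. `γ₁ι(a_{g₀})γ₁⁻¹` and `χ` extends the handle character `a_0 ↦ 1` resp.
`a_{g₀} ↦ 1`, which kills every cusp group and the node group, hence `Ker(Π_G ↠ Π^unr_G)` (abc-iut-f-165's
`unrKer_le_ker`).  Characters with prescribed handle AND cusp weights:
`PuncturedSurfaceGroup.exists_handleCuspCharacter` (generalising abc-iut-L3-t11's `exists_cuspCharacter`,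
abc-iut-f-165's `exists_hom_of_comm`).  Honest scope: components with exactly one marked point are not
covered (the node loop is then homologous to that cusp; non-abelian quotients would be needed).  Nothing
here takes a side on [IUTchIII] Cor. 3.12.
-/

noncomputable section

/-! ### Characters of `Γ_{g,r}` with handle and cusp weights -/

namespace Literature.GroupTheory.CombinatorialGroupTheory.PuncturedSurfaceGroup

open Multiplicative

variable {g r : ℕ}

/-- **Characters of `Γ_{g,r}`**: for weights `wa, wb : Fin g → ℤ/n` and `wc : Fin r → ℤ/n` with
`∑ wc = 0` there is a homomorphism `Γ_{g,r} → ℤ/n` (written multiplicatively) with `a_i ↦ wa i`,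
`b_i ↦ wb i`, `c_k ↦ wc k` — the commutators of the relator die in the abelian target and the cusp part
maps to `∑ wc = 0` (`H₁(S_{g,r}) = (ℤ^{2g} ⊕ ℤ^r)/(∑ c_k)`). [cite: MochizukiSemiAnbd2006, Ex. 2.10 p.31] -/
theorem exists_handleCuspCharacter {n : ℕ} (wa wb : Fin g → ZMod n) (wc : Fin r → ZMod n)
    (hw : ∑ k, wc k = 0) :
    ∃ φ : PuncturedSurfaceGroup g r →* Multiplicative (ZMod n),
      (∀ i, φ (a i) = ofAdd (wa i)) ∧ (∀ i, φ (b i) = ofAdd (wb i)) ∧ ∀ k, φ (c k) = ofAdd (wc k) := by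
  classical
  let f : puncturedSurfaceGen g r → Multiplicative (ZMod n) :=
    Sum.elim (fun p => ofAdd (if p.2 then wb p.1 else wa p.1)) fun k => ofAdd (wc k)
  have hrel : ∀ v ∈ ({relator g r} : Set (FreeGroup (puncturedSurfaceGen g r))),
      FreeGroup.lift f v = 1 := by
    intro v hv
    rw [Set.mem_singleton_iff] at hv
    subst hv
    simp only [relator, map_mul, map_list_prod, List.map_map, Function.comp_def, map_inv, genA, genB,
      genC, FreeGroup.lift_apply_of]
    have h1 : ((List.finRange g).map fun i =>
        f (Sum.inl (i, false)) * f (Sum.inl (i, true)) * (f (Sum.inl (i, false)))⁻¹ *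
          (f (Sum.inl (i, true)))⁻¹).prod = 1 :=
      List.prod_eq_one fun y hy => by
        obtain ⟨i, -, rfl⟩ := List.mem_map.mp hy
        rw [mul_inv_eq_one, mul_inv_eq_iff_eq_mul, mul_comm]
    have h2 : ((List.finRange r).map fun k => f (Sum.inr k)).prod = 1 := by
      simp only [f, Sum.elim_inr]
      rw [show (fun k => ofAdd (wc k)) = ofAdd ∘ wc from rfl, ← List.map_map, ← ofAdd_list_prod,
        ← Fin.sum_univ_def, hw, ofAdd_zero]
    rw [h1, h2, one_mul]
  refine ⟨PresentedGroup.toGroup hrel, fun i => ?_, fun i => ?_, fun k => ?_⟩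
  · rw [a, PresentedGroup.toGroup.of]; simp [f]
  · rw [b, PresentedGroup.toGroup.of]; simp [f]
  · rw [c, PresentedGroup.toGroup.of]; rfl

end Literature.GroupTheory.CombinatorialGroupTheory.PuncturedSurfaceGroup

namespace Literature.AnabelianGeometry.SemiGraphs

open scoped Pointwise
open Literature.GroupTheory.CombinatorialGroupTheory
open Literature.AnabelianGeometry.Anabelioids (IsSigmaInteger)
open SemiGraphOfAnabelioids (IsProSigmaCompletion)
open Multiplicative

universe u

namespace PSCDatum

/-! ### Bookkeeping for the two-component affine shape -/

namespace TwoComponentAffine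

variable {g r : ℕ}

/-- `ℓ^m` is a `Σ`-integer for `ℓ ∈ Σ` prime. [cite: MochizukiSemiAnbd2006, Ex. 2.10 p.31] -/
theorem isSigmaInteger_card_zmod_pow {Sigma : Set ℕ} {ℓ : ℕ} (hℓ : ℓ.Prime) (hℓS : ℓ ∈ Sigma)
    (m : ℕ) : IsSigmaInteger Sigma (Nat.card (Multiplicative (ZMod (ℓ ^ m)))) := by
  haveI : NeZero (ℓ ^ m) := ⟨(pow_pos hℓ.pos m).ne'⟩
  rw [show Nat.card (Multiplicative (ZMod (ℓ ^ m))) = ℓ ^ m from Nat.card_zmod _]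
  exact ⟨pow_pos hℓ.pos m, fun p hp hdvd =>
    ((Nat.prime_dvd_prime_iff_eq hp hℓ).mp (hp.dvd_of_dvd_pow hdvd)) ▸ hℓS⟩

/-- **Continuous extension of `ℤ/ℓ^m`-characters along a pro-`Σ` completion** (`ℓ ∈ Σ` prime): every
`φ : Γ → ℤ/ℓ^m` is `χ ∘ ι` for a continuous `χ : Π → ℤ/ℓ^m`
(`IsProSigmaCompletion.exists_continuous_extend_top`). [cite: MochizukiSemiAnbd2006, Ex. 2.10 p.31] -/
theorem exists_continuous_extend_zmod_pow {P : Type u} [Group P] [TopologicalSpace P]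
    [IsTopologicalGroup P] [CompactSpace P] [TotallyDisconnectedSpace P] {Sigma : Set ℕ} {Γ : Type*}
    [Group Γ] {ι : Γ →* P} (hι : IsProSigmaCompletion Sigma ι) {ℓ : ℕ} (hℓ : ℓ.Prime) (hℓS : ℓ ∈ Sigma)
    (m : ℕ) (φ : Γ →* Multiplicative (ZMod (ℓ ^ m))) :
    ∃ χ : P →* Multiplicative (ZMod (ℓ ^ m)), Continuous χ ∧ ∀ γ, χ (ι γ) = φ γ := by
  haveI : NeZero (ℓ ^ m) := ⟨(pow_pos hℓ.pos m).ne'⟩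
  exact hι.exists_continuous_extend_top (isSigmaInteger_card_zmod_pow hℓ hℓS m) φ

/-- A homomorphism to a commutative group is constant on conjugates.
[cite: MochizukiCombGC2007, Prop 1.2(i) p.8] -/
theorem map_conjAct_smul_eq_self {P : Type u} [Group P] {Q : Type*} [CommGroup Q] (χ : P →* Q)
    (δ : ConjAct P) (y : P) : χ (δ • y) = χ y := by
  rw [ConjAct.smul_def, map_mul, map_mul, map_inv, mul_inv_cancel_comm]

/-- Conjugates of a subgroup of a kernel lie in the kernel (kernels are normal) — conjugates `γ₂Π_wγ₂⁻¹`
are killed with `Π_w`. [cite: MochizukiCombGC2007, Prop 1.2(i) p.8] -/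
theorem smul_le_ker_of_le_ker {P : Type u} [Group P] {Q : Type*} [Group Q] {χ : P →* Q}
    {A : Subgroup P} (h : A ≤ χ.ker) (δ : ConjAct P) : δ • A ≤ χ.ker := by
  intro z hz
  obtain ⟨y, hy, rfl⟩ := (Subgroup.mem_smul_pointwise_iff_exists _ _ _).mp hz
  rw [ConjAct.smul_def]
  exact (MonoidHom.normal_ker χ).conj_mem y (h hy) (ConjAct.ofConjAct δ)

/-- Sums of a one-point weight over the cusps `s ≤ j` of `C₀` (weight bookkeeping for the node loop).
[cite: MochizukiCombGC2007, Prop 1.2(i) p.8] -/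
theorem sum_ite_ite_eq {n : ℕ} (s : ℕ) (k : Fin r) (t : ZMod n) :
    (∑ j : Fin r, if s ≤ (j : ℕ) then (if j = k then t else 0) else 0) =
      if s ≤ (k : ℕ) then t else 0 := by
  rw [Finset.sum_eq_single k (fun j _ hj => by simp [hj]) (fun h => absurd (Finset.mem_univ k) h)]
  simp

/-- The `C₀`-weight of the cusp weight `δ_k − δ_m` (the value of such a character on the node loop).
[cite: MochizukiCombGC2007, Prop 1.2(i) p.8] -/
theorem sum_ite_twoDelta {n : ℕ} (s : ℕ) (k m : Fin r) :
    (∑ j : Fin r, if s ≤ (j : ℕ) then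
        ((if j = k then (1 : ZMod n) else 0) + (if j = m then (-1 : ZMod n) else 0)) else 0) =
      (if s ≤ (k : ℕ) then (1 : ZMod n) else 0) + (if s ≤ (m : ℕ) then (-1 : ZMod n) else 0) := by
  have h : ∀ j : Fin r, (if s ≤ (j : ℕ) then
      ((if j = k then (1 : ZMod n) else 0) + (if j = m then (-1 : ZMod n) else 0)) else 0) =
      (if s ≤ (j : ℕ) then (if j = k then (1 : ZMod n) else 0) else 0) +
        (if s ≤ (j : ℕ) then (if j = m then (-1 : ZMod n) else 0) else 0) := by
    intro j
    split_ifs <;> simp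
  simp only [h]
  rw [Finset.sum_add_distrib, sum_ite_ite_eq, sum_ite_ite_eq]

/-- The cusp weight `δ_k − δ_m` has total weight `0` (so it is a character of `Γ_{g,r}`).
[cite: MochizukiCombGC2007, Prop 1.2(i) p.8] -/
theorem sum_twoDelta {n : ℕ} (k m : Fin r) :
    (∑ j : Fin r, ((if j = k then (1 : ZMod n) else 0) + (if j = m then (-1 : ZMod n) else 0))) = 0 := by
  simp only [Finset.sum_add_distrib, Finset.sum_ite_eq', Finset.mem_univ, if_true]
  exact add_neg_cancel 1

/-- **A character on the node loop**: `φ(ε) = ∑_{s ≤ j} wc j` for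
`ε = (c_s ⋯ c_{r−1}) · ∏_{i<g₀}[a_i,b_i]` — the commutators die in the abelian target.
[cite: MochizukiCombGC2007, Prop 1.2(i) p.8] -/
theorem character_nodeLoop {n : ℕ} (φ : PuncturedSurfaceGroup g r →* Multiplicative (ZMod n))
    {wc : Fin r → ZMod n} (hφc : ∀ k, φ (PuncturedSurfaceGroup.c k) = ofAdd (wc k)) (g₀ s : ℕ) :
    φ (((List.finRange r).map fun j : Fin r =>
          if s ≤ (j : ℕ) then PuncturedSurfaceGroup.c (g := g) j else 1).prod *
        ((List.finRange g).map fun i : Fin g => if (i : ℕ) < g₀ then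
          PuncturedSurfaceGroup.a (r := r) i * PuncturedSurfaceGroup.b i *
            (PuncturedSurfaceGroup.a i)⁻¹ * (PuncturedSurfaceGroup.b i)⁻¹ else 1).prod) =
      ofAdd (∑ j : Fin r, if s ≤ (j : ℕ) then wc j else 0) := by
  have hA : φ ((List.finRange g).map fun i : Fin g => if (i : ℕ) < g₀ then
      PuncturedSurfaceGroup.a (r := r) i * PuncturedSurfaceGroup.b i *
        (PuncturedSurfaceGroup.a i)⁻¹ * (PuncturedSurfaceGroup.b i)⁻¹ else 1).prod = 1 := by
    rw [map_list_prod, List.map_map]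
    refine List.prod_eq_one fun y hy => ?_
    obtain ⟨i, -, rfl⟩ := List.mem_map.mp hy
    simp only [Function.comp_apply, apply_ite φ, map_one, map_mul, map_inv]
    split_ifs
    · rw [mul_inv_eq_one, mul_inv_eq_iff_eq_mul, mul_comm]
    · rfl
  have hC : φ ((List.finRange r).map fun j : Fin r =>
      if s ≤ (j : ℕ) then PuncturedSurfaceGroup.c (g := g) j else 1).prod =
      ∏ j : Fin r, (if s ≤ (j : ℕ) then ofAdd (wc j) else 1) := by
    rw [map_list_prod, List.map_map, Fin.prod_univ_def]
    congr 1
    refine List.map_congr_left fun j _ => ?_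
    simp only [Function.comp_apply, apply_ite φ, map_one, hφc]
  rw [map_mul, hA, mul_one, hC, ofAdd_sum]
  refine Finset.prod_congr rfl fun j _ => ?_
  split_ifs <;> simp

end TwoComponentAffine

open TwoComponentAffine

variable {P : Type u} [Group P] [TopologicalSpace P] [IsTopologicalGroup P]
variable [CompactSpace P] [TotallyDisconnectedSpace P] {Sigma : Set ℕ} {g r : ℕ}

/-! ### Prop. 1.2 (i), verticial case -/

/-- **[CombGC] Prop. 1.2 (i), verticial case, at two-component affine shape.**  For `v ≠ w` the cusp
`c_s` of `C₀` resp. `c_0` of `C₁` lies in `Π_v`, and the continuous extension of the cusp character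
`c_s ↦ 1, c_{s+1} ↦ −1` resp. `c_0 ↦ 1, c_1 ↦ −1` to `ℤ/ℓⁿ` (`ℓ ∈ Σ`) kills every generator of `Π_w` — the
handles, the cusps of the other component, and the node loop `ε` (whose `C₀`-weight is `1 − 1 = 0` resp.
`0`); conclude by abc-iut-f-165's `verticialOpenInterDeterminesVertex_of_characters`.  Uses at least two
marked points on each component. [cite: MochizukiCombGC2007, Prop 1.2(i) p.8] -/
theorem verticialOpenInterDeterminesVertex_of_twoComponentAffine (hne : Sigma.Nonempty)
    (hprime : ∀ p ∈ Sigma, p.Prime) (ι : PuncturedSurfaceGroup g r →* P)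
    (hι : IsProSigmaCompletion Sigma ι) (G : PSCDatum P) {g₀ s : ℕ} (hs : 2 ≤ s) (hsr : s + 2 ≤ r)
    (v₀ v₁ : G.graph.V) (hV : ∀ w, w = v₀ ∨ w = v₁) (ε : PuncturedSurfaceGroup g r)
    (hε : ε = ((List.finRange r).map fun j : Fin r =>
          if s ≤ (j : ℕ) then PuncturedSurfaceGroup.c (g := g) j else 1).prod *
        ((List.finRange g).map fun i : Fin g => if (i : ℕ) < g₀ then
          PuncturedSurfaceGroup.a (r := r) i * PuncturedSurfaceGroup.b i *
            (PuncturedSurfaceGroup.a i)⁻¹ * (PuncturedSurfaceGroup.b i)⁻¹ else 1).prod)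
    (hV₀ : G.vertGp v₀ = ((Subgroup.closure {x : PuncturedSurfaceGroup g r |
        (∃ i : Fin g, (i : ℕ) < g₀ ∧ (x = PuncturedSurfaceGroup.a i ∨ x = PuncturedSurfaceGroup.b i)) ∨
        ∃ j : Fin r, s ≤ (j : ℕ) ∧ x = PuncturedSurfaceGroup.c j}).map ι).topologicalClosure)
    (hV₁ : G.vertGp v₁ = ((Subgroup.closure {x : PuncturedSurfaceGroup g r |
        (∃ i : Fin g, g₀ ≤ (i : ℕ) ∧ (x = PuncturedSurfaceGroup.a i ∨ x = PuncturedSurfaceGroup.b i)) ∨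
        (∃ j : Fin r, (j : ℕ) < s ∧ x = PuncturedSurfaceGroup.c j) ∨ x = ε}).map ι).topologicalClosure) :
    G.VerticialOpenInterDeterminesVertex := by
  classical
  obtain ⟨ℓ, hℓS⟩ := hne
  have hℓ : ℓ.Prime := hprime ℓ hℓS
  refine G.verticialOpenInterDeterminesVertex_of_characters hℓ.one_lt fun v w hvw => ?_
  -- the two cusps used on each side
  let j₀ : Fin r := ⟨s, by omega⟩
  let j₁ : Fin r := ⟨s + 1, by omega⟩
  let k₀ : Fin r := ⟨0, by omega⟩
  let k₁ : Fin r := ⟨1, by omega⟩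
  rcases hV v with hv | hv <;> rcases hV w with hw | hw
  · exact absurd (hv.trans hw.symm) hvw
  · -- `v = v₀`, `w = v₁`: `c_s ↦ 1`, `c_{s+1} ↦ -1`
    rw [hv, hw]
    refine ⟨ι (PuncturedSurfaceGroup.c j₀), ?_, fun m => ?_⟩
    · rw [hV₀]
      exact Subgroup.le_topologicalClosure _
        (Subgroup.mem_map_of_mem ι (Subgroup.subset_closure (Or.inr ⟨j₀, le_rfl, rfl⟩)))
    · let wc : Fin r → ZMod (ℓ ^ m) := fun l => (if l = j₀ then 1 else 0) + (if l = j₁ then -1 else 0)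
      obtain ⟨φ, hφa, hφb, hφc⟩ :=
        PuncturedSurfaceGroup.exists_handleCuspCharacter (g := g) 0 0 wc (sum_twoDelta j₀ j₁)
      obtain ⟨χ, hχc, hχ⟩ := exists_continuous_extend_zmod_pow hι hℓ hℓS m φ
      have hj : j₀ ≠ j₁ := fun h => by simp [j₀, j₁, Fin.ext_iff] at h
      refine ⟨χ, ?_, by rw [hχ, hφc]; simp [wc, hj]⟩
      rw [hV₁]
      refine topologicalClosure_map_closure_le_ker ι χ hχc _ ?_
      rintro y (⟨i, -, (rfl | rfl)⟩ | ⟨j, hj', rfl⟩ | rfl)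
      · rw [hχ, hφa]; rfl
      · rw [hχ, hφb]; rfl
      · have h0 : j ≠ j₀ := fun h => by simp [h, j₀] at hj'
        have h1 : j ≠ j₁ := fun h => by simp [h, j₁] at hj'
        rw [hχ, hφc]
        simp [wc, h0, h1]
      · rw [hχ, hε, character_nodeLoop φ hφc, sum_ite_twoDelta]
        simp [j₀, j₁]
  · -- `v = v₁`, `w = v₀`: `c_0 ↦ 1`, `c_1 ↦ -1`
    rw [hv, hw]
    refine ⟨ι (PuncturedSurfaceGroup.c k₀), ?_, fun m => ?_⟩
    · rw [hV₁]
      exact Subgroup.le_topologicalClosure _ (Subgroup.mem_map_of_mem ι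
        (Subgroup.subset_closure (Or.inr (Or.inl ⟨k₀, by change 0 < s; omega, rfl⟩))))
    · let wc : Fin r → ZMod (ℓ ^ m) := fun l => (if l = k₀ then 1 else 0) + (if l = k₁ then -1 else 0)
      obtain ⟨φ, hφa, hφb, hφc⟩ :=
        PuncturedSurfaceGroup.exists_handleCuspCharacter (g := g) 0 0 wc (sum_twoDelta k₀ k₁)
      obtain ⟨χ, hχc, hχ⟩ := exists_continuous_extend_zmod_pow hι hℓ hℓS m φ
      have hk : k₀ ≠ k₁ := fun h => by simp [k₀, k₁, Fin.ext_iff] at h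
      refine ⟨χ, ?_, by rw [hχ, hφc]; simp [wc, hk]⟩
      rw [hV₀]
      refine topologicalClosure_map_closure_le_ker ι χ hχc _ ?_
      rintro y (⟨i, -, (rfl | rfl)⟩ | ⟨j, hj', rfl⟩)
      · rw [hχ, hφa]; rfl
      · rw [hχ, hφb]; rfl
      · have h0 : j ≠ k₀ := fun h => by simp [h, k₀] at hj'; omega
        have h1 : j ≠ k₁ := fun h => by simp [h, k₁] at hj'; omega
        rw [hχ, hφc]
        simp [wc, h0, h1]
  · exact absurd (hv.trans hw.symm) hvw

end PSCDatum

end Literature.AnabelianGeometry.SemiGraphs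

end
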